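import Literature.NumberTheory.EllipticCurves.GreenbergVatsal2000.NonPrimitiveLambdaInvariantMultiplicative
import Literature.NumberTheory.EllipticCurves.GreenbergVatsal2000.NonPrimitiveLambdaInvariant
import Literature.NumberTheory.EllipticCurves.SelmerCorankControlCoinvariantsProofs
import Literature.NumberTheory.EllipticCurves.IwasawaSelmerDualProofs
import Summits.BirchSwinnertonDyer.Rank1Residual.X2.NonPrimitiveSelmerDual
import Summits.BirchSwinnertonDyer.Rank1Residual.X2.NonPrimitiveSelmerTorsionCard
import Summits.BirchSwinnertonDyer.Rank1Residual.X2.MuTransferDerived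
import HarnessLib

/-!
# The `ℤ_p`-CORANK of the non-primitive Selmer group: `corank_{ℤ_p} Sel^{Σ₀}_E(ℚ_∞)_p = λ(E) + Σ_{ℓ∈Σ₀} δ_E^{(ℓ)}`
# at `μ = 0` — at a prime `p ‖ N` of MULTIPLICATIVE reduction (and at a good ordinary prime)

HONEST FRAMING (BSD rank-`≤ 1` residual cell `b2b-bsdres`, home
`run/shared/lean/b2b/bsd-rank1-residual/`, unit `b2b-bsdres-eisenstein-p2`, class X2 = odd
multiplicative Eisenstein primes; research route, no claim beyond stated classes; nothing booked
here; labels unchanged): the cell deletes the COMBINATION-SHAPED residual classes of the rank-`≤ 1`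
BSD formula from PUBLISHED theorems only and TYPES the construction-shaped ones; this is not
"finishing BSD". Theorems only; axioms standard; no `sorry`.

WHAT THIS FILE PROVES (gen 13; step K-A of the `p ‖ N` bookkeeping for route G, X2-GAP §16.6/§17.4).
The kernel reads Iwasawa's `λ` through the tree's `ℤ_p`-corank calculus (`zpCorank`, file `Selmer`;
`ZpCorank.pow_zpCorank_mul_natCard_modN`: `#A[p] = p^{corank A} · #(A/pA)`;
`ZpCorank.finrank_eq_zpCorank_of_addEquiv_characterModule`: `rank_{ℤ_p} Hom(A, ℚ/ℤ) = corank A`):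
* `finite_torsionBy_and_zpCorank_eq_lambdaInvariant` (pure algebra): a `p`-primary group `S` whose
  character group is (as a group) a finitely generated `Λ`-torsion module `X` with `μ(X) = 0` has
  `S[p]` finite and `corank_{ℤ_p} S = λ(X)` — with NO divisibility hypothesis (contrast gen 11's
  `finite_and_natCard_torsionBy_eq_pow_lambdaInvariant_of_divisible`, which needs `S = pS` to read
  `#S[p]` itself);
* `finite_torsionBy_and_zpCorank_nonPrimitiveSelmerInfty_eq_multiplicative`: for `E/ℚ` globally
  minimal, `p` ODD with `p ‖ N`, `κ` cyclotomic, `Σ₀ ∌ p`, `μ(E) = 0` (any f.g. torsion dual datum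
  `D` with `D.mu = 0`): **`Sel^{Σ₀}_E(ℚ_∞)_p[p]` is finite and
  `corank_{ℤ_p} Sel^{Σ₀}_E(ℚ_∞)_p = λ(D.X) + Σ_{v∈Σ₀} δ_E^{(v)}`** — from the ONE printed statement
  GV (5)–(7) at a multiplicative prime (`hA` =
  `GreenbergVatsal2000.lambda_nonPrimitive_eq_add_sum_delta_multiplicative`, GV pp. 7–8, 14–15,
  Remark (2.10); Greenberg 1999 Lemma 4.6) and the kernel's dual datum `nonPrimitiveDualData`;
  `mu_nonPrimitive_eq_zero_multiplicative`: `μ(X^{Σ₀}) = 0`;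
* `…_goodOrdinary`: the same at a good ordinary `p` from A115 (`lambda_nonPrimitive_eq_add_sum_delta`).
Downstream (gen 13): at a NON-split `p ‖ N`, `Sel^{Σ₀} = S^{Σ₀}_{E[p^∞]}(ℚ_∞)` (gen 12) is divisible
(GV Prop. (2.5)/p. 25) so `#(S^{Σ₀} ⊓ H¹[p]) = p^{λ+Σδ}`; at a SPLIT `p ‖ N` the trivial zero adds
`corank 1` (GV p. 15) and `#(S^{Σ₀} ⊓ H¹[p]) = p^{λ+Σδ+1}`.

References: Greenberg–Vatsal, Invent. Math. 142 (2000) = arXiv:math/9906215, §1 (5)–(7) pp. 7–8,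
pp. 14–15, §2 Prop. (2.4), Remark (2.10); Greenberg, LNM 1716 (1999), §1 p. 60, Lemma 4.6 p. 105.
-/

noncomputable section

open scoped Classical AddSubgroup

universe u

namespace Summit.BirchSwinnertonDyer.Rank1Residual.X2.NonPrimitiveSelmerCorank

open NumberField IsDedekindDomain Field Literature.NumberTheory.GaloisRepresentations
  Literature.NumberTheory.EllipticCurves Literature.NumberTheory.EllipticCurves.GreenbergSelmer
  Literature.NumberTheory.EllipticCurves.GreenbergVatsal2000
  Summit.BirchSwinnertonDyer.Rank1Residual.X2.NonPrimitiveSelmerDual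
  Summit.BirchSwinnertonDyer.Rank1Residual.X2.NonPrimitiveSelmerTorsionCard

/-! ## §1. Algebra: `corank_{ℤ_p} S = λ(X)` for `X ≅ Hom(S, ℚ/ℤ)` f.g. torsion over `Λ` with `μ = 0` -/

section Algebra

variable (p : ℕ) [hp : Fact p.Prime] {S : Type*} [AddCommGroup S]
  (X : Type u) [AddCommGroup X] [Module (IwasawaAlgebra p) X]

/-- **`S[p]` is finite and `corank_{ℤ_p} S = λ(X)`** for a `p`-primary abelian group `S` whose
character group `Hom(S, ℚ/ℤ) ≅ X` (as groups) is a finitely generated torsion `Λ = ℤ_p⟦T⟧`-module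
with `μ(X) = 0`: `X` is then finitely generated over `ℤ_p` (`μ = 0`), so `S[p]` is finite
(`finite_torsionBy_of_addEquiv`) and `corank_{ℤ_p} S = rank_{ℤ_p} X`
(`ZpCorank.finrank_eq_zpCorank_of_addEquiv_characterModule`) `= λ(X)`
(`lambdaInvariant_eq_finrank`). Greenberg 1999 §1 p. 60 ("`λ_E = rank_{ℤ_p} X`"); Washington §13.2.
[folklore] -/
theorem finite_torsionBy_and_zpCorank_eq_lambdaInvariant [Module.Finite (IwasawaAlgebra p) X]
    (hX : Module.IsTorsion (IwasawaAlgebra p) X) (hμ : muInvariant p X = 0)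
    (hS : ∀ s : S, ∃ n : ℕ, p ^ n • s = 0) (Ψ : X ≃+ CharacterModule S) :
    Finite (S[(p : ℤ)]) ∧ zpCorank S p = lambdaInvariant p X := by
  letI : Module ℤ_[p] X := Module.compHom X (algebraMap ℤ_[p] (IwasawaAlgebra p))
  haveI : IsScalarTower ℤ_[p] (IwasawaAlgebra p) X := IsScalarTower.of_compHom ℤ_[p] _ X
  haveI : Module.Finite ℤ_[p] X := moduleFinite_int_of_muInvariant_eq_zero p X hX hμ
  haveI : Finite (S[(p : ℤ)]) := finite_torsionBy_of_addEquiv p Ψ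
  refine ⟨this, ?_⟩
  rw [← ZpCorank.finrank_eq_zpCorank_of_addEquiv_characterModule p hS Ψ,
    lambdaInvariant_eq_finrank p X]

end Algebra

/-! ## §2. `Sel^{Σ₀}_E(ℚ_∞)_p` at a prime of MULTIPLICATIVE reduction -/

section Multiplicative

variable (W : WeierstrassCurve ℚ) [W.IsElliptic] [W.IsGloballyMinimal] {p : ℕ} [Fact p.Prime]
  {κ : ZpExtension ℚ p} {γ : absoluteGaloisGroup ℚ} (S₀ : Finset (HeightOneSpectrum (𝓞 ℚ)))

omit [W.IsElliptic] [W.IsGloballyMinimal] in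
/-- Classes of `Sel^{Σ₀}_E(ℚ_∞)_p ⊆ H¹(ℚ_∞, E[p^∞])` are killed by powers of `p` (the Selmer group is
`p`-primary; Greenberg 1999 §1 p. 60). [cite: GreenbergLNM1716, §1 p. 60] -/
theorem isPrimary_nonPrimitiveSelmerInfty
    (s : nonPrimitiveSelmerInfty W κ (↑S₀ : Set (HeightOneSpectrum (𝓞 ℚ)))) :
    ∃ n : ℕ, p ^ n • s = 0 := by
  obtain ⟨n, hn⟩ := W.exists_pow_smul_subgroupH1_ker_eq_zero κ (s : W.subgroupH1 p κ.kerSubgroup)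
  exact ⟨n, Subtype.ext (by rw [AddSubgroupClass.coe_nsmul]; exact hn)⟩

/-- **The dual `X^{Σ₀}` at a multiplicative prime: finitely generated, `Λ`-torsion, `μ = 0` and
`λ(X^{Σ₀}) = λ(E) + Σ_{v∈Σ₀} δ_E^{(v)}`** when `μ(E) = 0` — GV (7) and "`μ_{E,Σ₀} = μ_E`" at `p ‖ N`
(`hA`), instantiated at the kernel's dual datum `nonPrimitiveDualData`.
[cite: GreenbergVatsal2000, §1 (7) p. 8; pp. 14–15; Remark (2.10)] -/
theorem dual_nonPrimitive_invariants_multiplicative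
    (hA : lambda_nonPrimitive_eq_add_sum_delta_multiplicative)
    (hp2 : p ≠ 2) (hmult : W.HasMultiplicativeReductionAtPrime p)
    (hκ : κ.IsCyclotomic) (hγ : κ.IsTopGenerator γ)
    (hS₀ : ∀ v ∈ S₀, ((p : ℕ) : 𝓞 ℚ) ∉ v.asIdeal)
    (D : W.SelmerDualData κ γ) [Module.Finite (IwasawaAlgebra p) D.X] (hX : D.IsTorsion)
    (hμ : D.mu = 0) :
    Module.Finite (IwasawaAlgebra p)
        (nonPrimitiveDualData W κ (↑S₀ : Set (HeightOneSpectrum (𝓞 ℚ))) hγ).X ∧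
      Module.IsTorsion (IwasawaAlgebra p)
        (nonPrimitiveDualData W κ (↑S₀ : Set (HeightOneSpectrum (𝓞 ℚ))) hγ).X ∧
      muInvariant p (nonPrimitiveDualData W κ (↑S₀ : Set (HeightOneSpectrum (𝓞 ℚ))) hγ).X = 0 ∧
      lambdaInvariant p (nonPrimitiveDualData W κ (↑S₀ : Set (HeightOneSpectrum (𝓞 ℚ))) hγ).X =
        lambdaInvariant p D.X + ∑ v ∈ S₀, delta W p v := by
  obtain ⟨hfg, htors, hmu, hlam⟩ :=
    hA W p hp2 hmult κ hκ γ hγ S₀ hS₀ D (nonPrimitiveDualData W κ _ hγ) hX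
  exact ⟨hfg, htors, by rw [hmu]; exact hμ, hlam⟩

/-- **`Sel^{Σ₀}_E(ℚ_∞)_p[p]` is finite and `corank_{ℤ_p} Sel^{Σ₀}_E(ℚ_∞)_p = λ(E) + Σ_{v∈Σ₀} δ_E^{(v)}`
at a prime `p ‖ N` of MULTIPLICATIVE reduction** (`E/ℚ` globally minimal, `p` odd, `κ` cyclotomic
with topological generator `γ`, `Σ₀ ∌ p`; `D` any f.g. `Λ`-torsion dual datum of `Sel_{p^∞}(E/ℚ_∞)`
with `μ = 0`), from GV (5)–(7) at `p ‖ N` (`hA`) — no divisibility needed.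
[cite: GreenbergVatsal2000, §1 (5)–(7) pp. 7–8; pp. 14–15; Remark (2.10)]
[cite: GreenbergLNM1716, §4 Lemma 4.6 (p. 105)] -/
theorem finite_torsionBy_and_zpCorank_nonPrimitiveSelmerInfty_eq_multiplicative
    (hA : lambda_nonPrimitive_eq_add_sum_delta_multiplicative)
    (hp2 : p ≠ 2) (hmult : W.HasMultiplicativeReductionAtPrime p)
    (hκ : κ.IsCyclotomic) (hγ : κ.IsTopGenerator γ)
    (hS₀ : ∀ v ∈ S₀, ((p : ℕ) : 𝓞 ℚ) ∉ v.asIdeal)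
    (D : W.SelmerDualData κ γ) [Module.Finite (IwasawaAlgebra p) D.X] (hX : D.IsTorsion)
    (hμ : D.mu = 0) :
    Finite ((nonPrimitiveSelmerInfty W κ (↑S₀ : Set (HeightOneSpectrum (𝓞 ℚ))))[(p : ℤ)]) ∧
      zpCorank (nonPrimitiveSelmerInfty W κ (↑S₀ : Set (HeightOneSpectrum (𝓞 ℚ)))) p =
        lambdaInvariant p D.X + ∑ v ∈ S₀, delta W p v := by
  set DS := nonPrimitiveDualData W κ (↑S₀ : Set (HeightOneSpectrum (𝓞 ℚ))) hγ with hDS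
  obtain ⟨hfg, htors, hmu, hlam⟩ :=
    dual_nonPrimitive_invariants_multiplicative W S₀ hA hp2 hmult hκ hγ hS₀ D hX hμ
  haveI := hfg
  have key := finite_torsionBy_and_zpCorank_eq_lambdaInvariant p DS.X htors hmu
    (isPrimary_nonPrimitiveSelmerInfty W S₀) (toDualEquiv W κ _ DS)
  rw [hlam] at key
  exact key

/-- **`μ`-reading at `p ‖ N`: if `Sel^{Σ₀}_E(ℚ_∞)_p[p]` is FINITE then `μ(E) = 0`** (`D` f.g.
torsion): `#Sel^{Σ₀}[p]` finite ⇒ `X^{Σ₀}/p` finite (Pontryagin,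
`finite_modN_characterModule_of_finite_torsionBy`) ⇒ `μ(X^{Σ₀}) = 0`
(`muInvariant_eq_zero_of_finite_modN`) ⇒ `μ(E) = μ(X^{Σ₀}) = 0` by GV's "`μ_E = μ_{E,Σ₀}`" at
`p ‖ N` (`hA`). The `μ`-half of the route-G transfer at the multiplicative member (GV p. 27
"if `μ_{E₁} = 0`, then `μ_{E₂} = 0`"). [cite: GreenbergVatsal2000, §1 (7) p. 8; §2 Prop. (2.8), p. 27] -/
theorem mu_eq_zero_of_finite_torsionBy_nonPrimitiveSelmerInfty_multiplicative
    (hA : lambda_nonPrimitive_eq_add_sum_delta_multiplicative)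
    (hp2 : p ≠ 2) (hmult : W.HasMultiplicativeReductionAtPrime p)
    (hκ : κ.IsCyclotomic) (hγ : κ.IsTopGenerator γ)
    (hS₀ : ∀ v ∈ S₀, ((p : ℕ) : 𝓞 ℚ) ∉ v.asIdeal)
    (D : W.SelmerDualData κ γ) [Module.Finite (IwasawaAlgebra p) D.X] (hX : D.IsTorsion)
    [Finite ((nonPrimitiveSelmerInfty W κ (↑S₀ : Set (HeightOneSpectrum (𝓞 ℚ))))[(p : ℤ)])] :
    D.mu = 0 := by
  set DS := nonPrimitiveDualData W κ (↑S₀ : Set (HeightOneSpectrum (𝓞 ℚ))) hγ with hDS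
  obtain ⟨hfg, htors, hmu, -⟩ := hA W p hp2 hmult κ hκ γ hγ S₀ hS₀ D DS hX
  haveI := hfg
  haveI : Finite (ModN (CharacterModule
      (nonPrimitiveSelmerInfty W κ (↑S₀ : Set (HeightOneSpectrum (𝓞 ℚ))))) p) :=
    MuTransferDerived.finite_modN_characterModule_of_finite_torsionBy p
  haveI : Finite (ModN DS.X p) :=
    Finite.of_equiv _ (modNEquiv (toDualEquiv W κ _ DS) p).symm.toEquiv
  have hμS : muInvariant p DS.X = 0 :=
    MuVanishingOfFiniteModP.muInvariant_eq_zero_of_finite_modN p DS.X htors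
  change muInvariant p D.X = 0
  rw [← hmu]; exact hμS

end Multiplicative

/-! ## §3. The same at a good ORDINARY prime (from A115) -/

section GoodOrdinary

variable (W : WeierstrassCurve ℚ) [W.IsElliptic] [W.IsGloballyMinimal] {p : ℕ} [Fact p.Prime]
  {κ : ZpExtension ℚ p} {γ : absoluteGaloisGroup ℚ} (S₀ : Finset (HeightOneSpectrum (𝓞 ℚ)))

/-- **`Sel^{Σ₀}_E(ℚ_∞)_p[p]` finite and `corank_{ℤ_p} Sel^{Σ₀}_E(ℚ_∞)_p = λ(E) + Σ_{v∈Σ₀} δ_E^{(v)}` at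
a good ORDINARY odd `p`** with `μ(E) = 0`, from GV (7) (`hA` = A115).
[cite: GreenbergVatsal2000, §1 (5)–(7) pp. 7–8; §2 Cor. (2.3), Prop. (2.4), p. 26] -/
theorem finite_torsionBy_and_zpCorank_nonPrimitiveSelmerInfty_eq_goodOrdinary
    (hA : lambda_nonPrimitive_eq_add_sum_delta)
    (hp2 : p ≠ 2) (hgood : W.HasGoodReductionAtPrime p) (hord : ¬ (p : ℤ) ∣ W.frobeniusTrace p)
    (hκ : κ.IsCyclotomic) (hγ : κ.IsTopGenerator γ)
    (hS₀ : ∀ v ∈ S₀, ((p : ℕ) : 𝓞 ℚ) ∉ v.asIdeal)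
    (D : W.SelmerDualData κ γ) [Module.Finite (IwasawaAlgebra p) D.X] (hX : D.IsTorsion)
    (hμ : D.mu = 0) :
    Finite ((nonPrimitiveSelmerInfty W κ (↑S₀ : Set (HeightOneSpectrum (𝓞 ℚ))))[(p : ℤ)]) ∧
      zpCorank (nonPrimitiveSelmerInfty W κ (↑S₀ : Set (HeightOneSpectrum (𝓞 ℚ)))) p =
        lambdaInvariant p D.X + ∑ v ∈ S₀, delta W p v := by
  set DS := nonPrimitiveDualData W κ (↑S₀ : Set (HeightOneSpectrum (𝓞 ℚ))) hγ with hDS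
  obtain ⟨hfg, htors, hmu, hlam⟩ := hA W p hp2 hgood hord κ hκ γ hγ S₀ hS₀ D DS hX
  haveI := hfg
  have hμS : muInvariant p DS.X = 0 := by rw [hmu]; exact hμ
  have key := finite_torsionBy_and_zpCorank_eq_lambdaInvariant p DS.X htors hμS
    (isPrimary_nonPrimitiveSelmerInfty W S₀) (toDualEquiv W κ _ DS)
  rw [hlam] at key
  exact key

end GoodOrdinary

end Summit.BirchSwinnertonDyer.Rank1Residual.X2.NonPrimitiveSelmerCorank

end
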